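import Summits.QuantumFields.YangMills.Theorems.LuscherReductionTwistedTraceScalingBOStiffColour
import HarnessLib

/-!
# (B-ST) step (D2): THE BASED-AVERAGED KERNEL IS POSITIVE SEMI-DEFINITE ON EVERY PARAMETRISED FAMILY — in particular the central fibre form `B₁(f,f) ≥ 0`
# (lane A of S-BASE, crux `TwistedTraceScaling` stmt-QuantumFields-20203, C4-CORE, the (B-ST) pen; design card `pub/ym-fleet/ym-luscher-20007-p1/Lines-BST-poincare.md` (D2))

After step (A) (`…BOStiffColour`) the tube form is bounded by the form of the BASED-AVERAGED kernel `G(U,V) = ∫ K_β(U, V^{basedExt h}) dh`, and after transport to the central fibre the stiff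
brick becomes a statement about the fibre form `B₁(f,f') = ∫∫ f(x) G(oT 1 x, oT 1 x') f'(x') dπ dπ`.  The Poincaré door gives the QUADRATIC bound on `B₁(h,h)`; the slow direction is then
handled by the operator norm of the one-site kernel (`…BOStiffSlowTop`) applied to `u ↦ ‖v_u‖`, which needs the BILINEAR bound `|B₁(h,h')| ≤ √(B₁(h,h)B₁(h',h'))` — Cauchy–Schwarz, i.e.
positive semi-definiteness of `B₁`.  This file proves it in the natural generality: for ANY measurable parametrisation `Ψ : W → configurations` and any finite measure `ν` on `W`,
★★★ `integral_integral_basedKernel_nonneg`:  `0 ≤ ∫∫ f(w)·(∫ K_β(Ψ w, (Ψ w')^{basedExt h}) dh)·f(w') dν dν`  (`β ≥ 0`, `f` bounded measurable):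
the double based average `∫∫ K_β((Ψw)^{h₁}, (Ψw')^{h₂})` equals the single one (invariance of `K_β`, of Haar), so the form is the Gram-exponential form of `FemtoTransferGapPositivityGram`
on `W × G₀` (Cauchy–Schwarz for the bilinear form then follows from bilinearity, next file).  Instances: `W` = the cap with `π = orthoTransverse`, `Ψ = orthoTube L u` (any slow point `u`).
HONEST FRAMING: exact bookkeeping for a stub of a child of the CONDITIONAL route R2b1; (B-ST) OPEN; C4-CORE OPEN; not infinite volume, not a gap, not Clay.
-/

set_option autoImplicit false

noncomputable section

open MeasureTheory Filter Topology Real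
open scoped BigOperators
open Literature.MathematicalPhysics.QuantumFieldTheory
open Literature.MathematicalPhysics.QuantumLattice

namespace Summit.QuantumFields.YangMills.Theorems.FemtoTransferGap.TwoLattice.ConstTube

open Summit.QuantumFields.YangMills.Theorems.FemtoTransferGap
open Summit.QuantumFields.YangMills.Theorems.FemtoTransferGap.TwoLattice.Avg

variable {L : ℕ} [NeZero L] {W : Type*} [MeasurableSpace W] {ν : Measure W} [IsFiniteMeasure ν]

/-! ## §1 The based extension is a homomorphism -/

omit [NeZero L] in
/-- `basedExt (h₁⁻¹ * h₂) = (basedExt h₁)⁻¹ * basedExt h₂`. [folklore] -/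
theorem basedExt_inv_mul (h₁ h₂ : NzSite L → SU2) : basedExt L (h₁⁻¹ * h₂) = (basedExt L h₁)⁻¹ * basedExt L h₂ := by
  funext x
  by_cases hx : x = 0
  · subst hx; simp [basedExt]
  · simp [basedExt, hx]

/-! ## §2 The double based average equals the single one -/

/-- `∫_{h₂} K_β(U^{basedExt h₁}, V^{basedExt h₂}) dh₂ = ∫_h K_β(U, V^{basedExt h}) dh` (kernel invariance + left invariance of Haar on the based group). [cite: SeilerLNP1982, §3] -/
theorem integral_transferKernel_based_based (β : ℝ) (U V : GaugeConfig 3 L SU2) (h₁ : NzSite L → SU2) :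
    ∫ h₂, transferKernel su2Rep β (gaugeTransform (basedExt L h₁) U) (gaugeTransform (basedExt L h₂) V) ∂basedMeasure L =
      ∫ h, transferKernel su2Rep β U (gaugeTransform (basedExt L h) V) ∂basedMeasure L := by
  have e : ∀ h₂, transferKernel su2Rep β (gaugeTransform (basedExt L h₁) U) (gaugeTransform (basedExt L h₂) V) =
      (fun h => transferKernel su2Rep β U (gaugeTransform (basedExt L h) V)) (h₁⁻¹ * h₂) := fun h₂ => by
    dsimp only
    rw [← transferKernel_gaugeTransform su2Rep β (basedExt L h₁)⁻¹ (gaugeTransform (basedExt L h₁) U) (gaugeTransform (basedExt L h₂) V),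
      gaugeTransform_gaugeTransform, gaugeTransform_gaugeTransform, inv_mul_cancel, basedExt_inv_mul]
    have e1 : gaugeTransform (1 : Site 3 L → SU2) U = U := by funext e; simp [gaugeTransform]
    rw [e1]
  simp_rw [e]
  exact integral_mul_left_eq_self (fun h => transferKernel su2Rep β U (gaugeTransform (basedExt L h) V)) h₁⁻¹

/-- The based average as a DOUBLE average: `∫ K_β(U, V^{basedExt h}) dh = ∫_{h₁}∫_{h₂} K_β(U^{basedExt h₁}, V^{basedExt h₂}) dh₂ dh₁`. [folklore] -/
theorem basedKernel_eq_double (β : ℝ) (U V : GaugeConfig 3 L SU2) :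
    ∫ h, transferKernel su2Rep β U (gaugeTransform (basedExt L h) V) ∂basedMeasure L =
      ∫ h₁, ∫ h₂, transferKernel su2Rep β (gaugeTransform (basedExt L h₁) U) (gaugeTransform (basedExt L h₂) V) ∂basedMeasure L ∂basedMeasure L := by
  haveI : IsProbabilityMeasure (basedMeasure L) := by unfold basedMeasure; infer_instance
  simp_rw [integral_transferKernel_based_based]
  simp [integral_const]

/-! ## §3 ★★★ Positive semi-definiteness on a parametrised family -/

/-- The features of the parametrised, based-transformed configuration `(w, h) ↦ suFeature a ((Ψ w)^{basedExt h})` are measurable. [folklore] -/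
theorem measurable_feature_param {Ψ : W → GaugeConfig 3 L SU2} (hΨ : Measurable Ψ) (a : Edge 3 L × (Fin 2 × Fin 2) × Bool) :
    Measurable fun p : W × (NzSite L → SU2) => suFeature 2 L a (gaugeTransform (basedExt L p.2) (Ψ p.1)) := by
  have h1 : Measurable fun p : W × (NzSite L → SU2) => (Ψ p.1, basedExt L p.2) := (hΨ.comp measurable_fst).prodMk ((measurable_basedExt L).comp measurable_snd)
  have h2 : Measurable fun p : W × (NzSite L → SU2) => gaugeTransform (basedExt L p.2) (Ψ p.1) := by
    have h := (measurable_gaugeAction (L := L)).comp h1; simpa only [Function.comp_def] using h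
  exact (continuous_suFeature L a).measurable.comp h2

/-- ★★★ **THE BASED-AVERAGED KERNEL IS POSITIVE SEMI-DEFINITE ON EVERY PARAMETRISED FAMILY**: for `β ≥ 0`, a finite measure `ν` on `W`, a measurable `Ψ : W → configurations` and a bounded
measurable `f`, `0 ≤ ∫∫ f(w)·(∫ K_β(Ψ w, (Ψ w')^{basedExt h}) dh)·f(w') dν(w') dν(w)`. [cite: OsterwalderSeiler1978, §2] -/
theorem integral_integral_basedKernel_nonneg {β : ℝ} (hβ : 0 ≤ β) {Ψ : W → GaugeConfig 3 L SU2} (hΨ : Measurable Ψ) {f : W → ℝ} (hf : Measurable f) {Cf : ℝ}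
    (hCf : ∀ w, |f w| ≤ Cf) :
    0 ≤ ∫ w, ∫ w', f w * (∫ h, transferKernel su2Rep β (Ψ w) (gaugeTransform (basedExt L h) (Ψ w')) ∂basedMeasure L) * f w' ∂ν ∂ν := by
  haveI : SecondCountableTopology SU2 := secondCountableTopology_su2
  haveI : IsProbabilityMeasure (basedMeasure L) := by unfold basedMeasure; infer_instance
  obtain ⟨M, hM⟩ := exists_transferKernel_le su2Rep continuous_su2Rep β (L := L)
  have hM0 : 0 ≤ M := (transferKernel_pos su2Rep β (1 : GaugeConfig 3 L SU2) 1).le.trans (hM 1 1)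
  have hCf0 : ∀ w, 0 ≤ Cf := fun w => (abs_nonneg _).trans (hCf w)
  -- the configuration map on `W × G₀`
  set X : W × (NzSite L → SU2) → GaugeConfig 3 L SU2 := fun p => gaugeTransform (basedExt L p.2) (Ψ p.1) with hX
  have hXm : Measurable X := by
    have h1 : Measurable fun p : W × (NzSite L → SU2) => (Ψ p.1, basedExt L p.2) := (hΨ.comp measurable_fst).prodMk ((measurable_basedExt L).comp measurable_snd)
    have h := (measurable_gaugeAction (L := L)).comp h1; simpa only [Function.comp_def] using h
  have hK : Measurable fun q : GaugeConfig 3 L SU2 × GaugeConfig 3 L SU2 => transferKernel su2Rep β q.1 q.2 := (continuous_transferKernel su2Rep continuous_su2Rep β).measurable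
  -- the 4-variable integrand
  set F4 : (W × (NzSite L → SU2)) × (W × (NzSite L → SU2)) → ℝ := fun pq => f pq.1.1 * transferKernel su2Rep β (X pq.1) (X pq.2) * f pq.2.1 with hF4
  have hF4m : Measurable F4 := ((hf.comp (measurable_fst.comp measurable_fst)).mul (hK.comp ((hXm.comp measurable_fst).prodMk (hXm.comp measurable_snd)))).mul
    (hf.comp (measurable_fst.comp measurable_snd))
  have hF4b : ∀ pq, |F4 pq| ≤ Cf * M * Cf := fun pq => by
    simp only [hF4]; rw [abs_mul, abs_mul, abs_of_pos (transferKernel_pos su2Rep β _ _)]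
    exact mul_le_mul (mul_le_mul (hCf _) (hM _ _) (transferKernel_pos su2Rep β _ _).le (hCf0 pq.1.1)) (hCf _) (abs_nonneg _) (mul_nonneg (hCf0 pq.1.1) hM0)
  -- step 1: rewrite the based average as a double average and pull `f` inside
  have e1 : ∀ w w', f w * (∫ h, transferKernel su2Rep β (Ψ w) (gaugeTransform (basedExt L h) (Ψ w')) ∂basedMeasure L) * f w' =
      ∫ h₁, ∫ h₂, F4 ((w, h₁), (w', h₂)) ∂basedMeasure L ∂basedMeasure L := fun w w' => by
    rw [basedKernel_eq_double]
    symm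
    calc ∫ h₁, ∫ h₂, F4 ((w, h₁), (w', h₂)) ∂basedMeasure L ∂basedMeasure L
        = ∫ h₁, (f w * ∫ h₂, transferKernel su2Rep β (gaugeTransform (basedExt L h₁) (Ψ w)) (gaugeTransform (basedExt L h₂) (Ψ w')) ∂basedMeasure L) * f w'
            ∂basedMeasure L := by
          refine integral_congr_ae (ae_of_all _ fun h₁ => ?_)
          simp only [hF4, hX]
          rw [integral_mul_const, integral_const_mul]
      _ = (f w * ∫ h₁, ∫ h₂, transferKernel su2Rep β (gaugeTransform (basedExt L h₁) (Ψ w)) (gaugeTransform (basedExt L h₂) (Ψ w')) ∂basedMeasure L ∂basedMeasure L) * f w' := by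
          rw [integral_mul_const, integral_const_mul]
  simp_rw [e1]
  -- step 2: Fubini to the product space `(W × G₀) × (W × G₀)`
  set muH : Measure (W × (NzSite L → SU2)) := ν.prod (basedMeasure L) with hmuH
  have i4 : Integrable F4 (muH.prod muH) := integrable_of_measurable_abs_le _ hF4m hF4b
  have hgoal : ∫ w, ∫ w', ∫ h₁, ∫ h₂, F4 ((w, h₁), (w', h₂)) ∂basedMeasure L ∂basedMeasure L ∂ν ∂ν = ∫ pq, F4 pq ∂(muH.prod muH) := by
    rw [integral_prod _ i4]
    rw [integral_prod _ i4.integral_prod_left]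
    refine integral_congr_ae (ae_of_all _ fun w => ?_)
    dsimp only
    -- inner: `∫_{w'} ∫_{h₁} ∫_{h₂} = ∫_{h₁} ∫_{(w',h₂)}`
    have h2 : ∫ h₁, ∫ q, F4 ((w, h₁), q) ∂muH ∂basedMeasure L = ∫ h₁, ∫ w', ∫ h₂, F4 ((w, h₁), (w', h₂)) ∂basedMeasure L ∂ν ∂basedMeasure L := by
      refine integral_congr_ae (ae_of_all _ fun h₁ => ?_)
      dsimp only
      have iq : Integrable (fun q : W × (NzSite L → SU2) => F4 ((w, h₁), q)) muH :=
        integrable_of_measurable_abs_le _ (hF4m.comp (measurable_const.prodMk measurable_id)) (fun q => hF4b _)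
      rw [hmuH, integral_prod _ iq]
    have h3 : ∫ h₁, ∫ w', ∫ h₂, F4 ((w, h₁), (w', h₂)) ∂basedMeasure L ∂ν ∂basedMeasure L = ∫ w', ∫ h₁, ∫ h₂, F4 ((w, h₁), (w', h₂)) ∂basedMeasure L ∂basedMeasure L ∂ν := by
      have iw' : Integrable (Function.uncurry fun h₁ w' => ∫ h₂, F4 ((w, h₁), (w', h₂)) ∂basedMeasure L) ((basedMeasure L).prod ν) := by
        have hm : Measurable fun q : ((NzSite L → SU2) × W) × (NzSite L → SU2) => F4 ((w, q.1.1), (q.1.2, q.2)) :=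
          hF4m.comp ((measurable_const.prodMk (measurable_fst.comp measurable_fst)).prodMk ((measurable_snd.comp measurable_fst).prodMk measurable_snd))
        refine integrable_of_measurable_abs_le _ (hm.stronglyMeasurable.integral_prod_right' (ν := basedMeasure L)).measurable (C := Cf * M * Cf * (basedMeasure L).real Set.univ)
          fun q => ?_
        have h := norm_integral_le_of_norm_le_const (μ := basedMeasure L) (f := fun h₂ => F4 ((w, q.1), (q.2, h₂))) (C := Cf * M * Cf)
          (Filter.Eventually.of_forall fun h₂ => by rw [Real.norm_eq_abs]; exact hF4b _)
        rw [Real.norm_eq_abs] at h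
        simpa [Function.uncurry, mul_comm] using h
      exact integral_integral_swap iw'
    rw [← h3, ← h2]
  rw [hgoal]
  -- step 3: the Gram structure on `W × G₀`
  have hw_cont : Continuous fun U : GaugeConfig 3 L SU2 => Real.exp (-(β / 2) * wilsonAction su2Rep U) :=
    Real.continuous_exp.comp (continuous_const.mul (continuous_wilsonAction su2Rep continuous_su2Rep))
  obtain ⟨Wb, hWb⟩ := (isCompact_range hw_cont).bddAbove
  have hWle : ∀ U, Real.exp (-(β / 2) * wilsonAction su2Rep U) ≤ Wb := fun U => hWb (Set.mem_range_self U)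
  set Φ : W × (NzSite L → SU2) → ℝ := fun p => f p.1 * Real.exp (-(β / 2) * wilsonAction su2Rep (X p)) with hΦ
  have hΦm : Measurable Φ := (hf.comp measurable_fst).mul (hw_cont.measurable.comp hXm)
  have hΦb : ∀ p, |Φ p| ≤ Cf * Wb := fun p => by
    simp only [hΦ]; rw [abs_mul, abs_of_pos (Real.exp_pos _)]
    exact mul_le_mul (hCf _) (hWle _) (Real.exp_pos _).le (hCf0 p.1)
  have hgm : ∀ a, Measurable fun p : W × (NzSite L → SU2) => suFeature 2 L a (X p) := fun a => (continuous_suFeature L a).measurable.comp hXm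
  have hgb : ∀ a (p : W × (NzSite L → SU2)), |suFeature 2 L a (X p)| ≤ 1 := fun a p => abs_suFeature_le_one L a _
  have hK4 : ∀ pq, F4 pq = Φ pq.1 * Real.exp (β * ∑ a, suFeature 2 L a (X pq.1) * suFeature 2 L a (X pq.2)) * Φ pq.2 := fun pq => by
    simp only [hF4, hΦ]
    rw [← timeCoupling_fundamentalRep_eq_gram]
    simp only [transferKernel]
    rw [show β * timeCoupling su2Rep (X pq.1) (X pq.2) - β / 2 * (wilsonAction su2Rep (X pq.1) + wilsonAction su2Rep (X pq.2)) =
        β * timeCoupling su2Rep (X pq.1) (X pq.2) + -(β / 2) * wilsonAction su2Rep (X pq.1) + -(β / 2) * wilsonAction su2Rep (X pq.2) by ring, Real.exp_add, Real.exp_add]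
    ring
  simp_rw [hK4]
  rcases isEmpty_or_nonempty W with hW | ⟨⟨w₀⟩⟩
  · simp [Measure.eq_zero_of_isEmpty]
  exact integral_prod_exp_gram_nonneg muH (fun a p => suFeature 2 L a (X p)) hgm zero_le_one hgb Φ hΦm (mul_nonneg (hCf0 w₀) ((Real.exp_pos _).le.trans (hWle 1))) hΦb hβ

end Summit.QuantumFields.YangMills.Theorems.FemtoTransferGap.TwoLattice.ConstTube

end
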